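import Summits.Schanuel.Schanuel.Theorems.RootDecomp1BMovingZero02
import Mathlib
import Literature.Analysis.Complex.LaurentExpansionEval
import Literature.RingTheory.PowerSeries.LaurentSeriesConstants
import Literature.FieldTheory.TranscendenceDegree.AlgebraicDependenceBookkeeping

/-!
# RootDecomp1BMovingZero — lens 4, generation 35/36 «AX-TRANSVERSAL MOVING ZERO»: T″ = `IsolatedIntersectionGeneral` PROVED modulo ONE print fact (`CurveSelection`) + the tree Ax statement, and SUB-PIECE A = `AnalyticMovingZero` PROVED modulo TWO print facts (`RoucheMaps`, `IsolatedZeroLowerBound`) — continuation (RootDecomp1BMovingZero03): §G03/§G the BASE-POINT-GENERAL form T″ (`IsolatedIntersectionGeneral`), T″ ⟹ Strong ⟹ T, the √2 witness, the positive instance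

(lens-4 g35 HOME kernels MovingZeroTpp.lean 6bf08f88…de4e (2338 l = §G03 MovingZeroGeneral03 b461aa70… + §E MovingZeroExpPoly fdd5ca6b… + §X MovingZeroAxGerms a74f0949… verbatim
bodies + NEW §T) and MovingZeroPieceA.lean 8899dedb…8da9 (238 l); ADDENDUM-2 L1857, writer re-check L1858, critic RULING L1859 (T″ VERIFIED and BOOKED; `CurveSelection`
ACCEPTED as THE ONE T-fact), RESULT/DONE L1865, critic RULING/ADDENDUM L1867 (A VERIFIED and BOOKED; `RoucheMaps` / `IsolatedZeroLowerBound` ACCEPTED AS TYPED),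
lens-4 g36 NOTE/CLAIM L1871 (PORT-READY) and critic ACK L1875 (PORT STAGING GO; credits T (L1859) and A (L1867) paid at the critic's verification of the
accepted parts carrying `isolatedIntersectionGeneral_of_curveSelection` resp. `analyticMovingZero_of_facts`); port by census-1 gen 17 as `RootDecomp1BMovingZero03`–`10`
PORT EDITS: the 44 `#guard_msgs in #print axioms` guards and their section headers dropped (HOME probes); `set_option linter.dupNamespace false` dropped; PieceA's
character-identical copy of `AnalyticMovingZero` dropped (§A's definition is used; its Facts + Proof sections follow §A in part 04); the four re-proved
`AxSchanuelTwoGerms` helpers (`exists_algDerivation_eq_derivative'`, `ofPowerSeries_taylor_exp_ne_zero'`, `algebraMap_eq_ofPowerSeries_C'`, `taylor_const'`) PRIVATE in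
part 08 (statement-twins of the unbuilt Literature module) with a notation-free private copy `taylor_const''` in part 09; `CurveSelection`'s docstring replaced by the
FACT (T-ii) text dictated in L1871 (ACK L1875); nine one-line docstrings added; statements and proofs otherwise verbatim; `AxRankBoundLaurent` stays a binder BY
NAME (discharge: HOME MovingZeroAxGermsTree.lean c3203867… once `AxSchanuelUniv` builds on the farm). `--supports stmt-Schanuel-32406`; no census credit carried;
rung 0 — nothing here proves Schanuel.)
-/

noncomputable section

namespace Summit.Schanuel.Schanuel.Theorems.RootDecomp1BMovingZero

/-! # §G03 — `MovingZeroGeneral03.lean` (verbatim body) -/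
section G03part

open Complex Polynomial

open Summit.Schanuel.Schanuel.Theorems.RootDecomp1KHyper (LWMeasure)
open Summit.Schanuel.Schanuel.Theorems.RootDecomp1KHyper.HyperCell (ExplicitRatExpApprox)
open Summit.Schanuel.Schanuel.Theorems.RootDecomp1KGeneric (LiouvilleOrder)
open Summit.Schanuel.Schanuel.Theorems.RootDecomp1BFedFlagCore (polarDeg)

/-! ## §G  BASE-POINT-GENERAL FORM OF T (critic VERDICT L1819 (δ)(T-i))

G-1 `IsolatedAt' ρ X₀ Y₀ G₁ G₂` / `GenuineAt ρ X₀ Y₀ G₁ G₂` — isolatedness and genuineness AT a general base point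
    `θ′ = (X₀, Y₀)`; at `θ = (e, e^i)` the first IS `IsolatedAt` (`Iff.rfl`) and the second is a CONSEQUENCE of the
    a.i. triple + top coefficients `≠ 0` (PROVED, `genuineAt_theta`, = Step 0 of NODE.md §3).
G-2 T″ = `IsolatedIntersectionGeneral` (typed, OPEN): for real `ρ` with `1, ρ, ρ²` ℚ-linearly independent and
    `X₀, Y₀` off the cut `(-∞, 0]`, every pair of coefficient families GENUINE AT θ′ has an isolated intersection
    of its two curves at θ′.  PROVED: T″ ⟹ `IsolatedIntersectionStrong ρ` ⟹ T for every `ρ`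
    (`isolatedIntersectionStrong_of_general`), via a.i. triple ⟹ `ρ` transcendental ⟹ `1, ρ, ρ²` free.
G-3 NEGATIVE planted instance = `_false_without_` the `ρ`-hypothesis (the critic's witness): `ρ = √2`,
    `θ′ = (2, 2^{√2})`, `𝒞₁ = {X^ρ = Y}`, `𝒞₂ = {Y^ρ = X²}` — genuine at θ′, NOT isolated (common real branch
    `Y = X^{√2}`, since `(x^{√2})^{√2} = x²`): `not_isolatedAt'_sqrt_two`, `isolatedIntersectionGeneral_false_without_rho`;
    and `1, √2, √2²` ARE ℚ-dependent (`not_linearIndependent_sqrt_two`), so T″ itself is untouched.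
G-4 POSITIVE non-trivial planted instance: `θ′ = (1, 1)`, `𝒞₁ = {X^ρ = 1}`, `𝒞₂ = {Y^ρ = 1}`, ANY `ρ ≠ 0`:
    isolated (`isolatedAt'_one_one`) — principal-branch LOCALITY at work (`|ρ log X| < 2π` forces `log X = 0`).
G-5 the cell from T″ and M′: `four_le_polarDeg_one_of_general`.
-/

section General

/-- Isolatedness of the intersection of the two relation curves (principal branches `exp(ρ log ·)`) AT a general
base point `θ′ = (X₀, Y₀)`. -/
def IsolatedAt' (ρ : ℝ) (X₀ Y₀ : ℂ) {K₁ K₂ : ℕ} (G₁ : Fin (K₁ + 1) → MvPolynomial (Fin 3) ℤ)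
    (G₂ : Fin (K₂ + 1) → MvPolynomial (Fin 3) ℤ) : Prop :=
  ∃ ε : ℝ, 0 < ε ∧ ∀ X Y : ℂ, ‖X - X₀‖ < ε → ‖Y - Y₀‖ < ε →
    relEval G₁ ρ X Y (cexp (ρ * Complex.log X)) = 0 → relEval G₂ ρ X Y (cexp (ρ * Complex.log Y)) = 0 →
      X = X₀ ∧ Y = Y₀

/-- At `θ = (e, e^i)`, `IsolatedAt'` IS the kernel's `IsolatedAt`. -/
theorem isolatedAt_iff_isolatedAt' (ρ : ℝ) {K₁ K₂ : ℕ} (G₁ : Fin (K₁ + 1) → MvPolynomial (Fin 3) ℤ)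
    (G₂ : Fin (K₂ + 1) → MvPolynomial (Fin 3) ℤ) :
    IsolatedAt ρ G₁ G₂ ↔ IsolatedAt' ρ (cexp 1) (cexp Complex.I) G₁ G₂ := Iff.rfl

/-- GENUINENESS AT θ′: the top `W`-coefficients of both families do not vanish at `(ρ, X₀, Y₀)`. -/
def GenuineAt (ρ : ℝ) (X₀ Y₀ : ℂ) {K₁ K₂ : ℕ} (G₁ : Fin (K₁ + 1) → MvPolynomial (Fin 3) ℤ)
    (G₂ : Fin (K₂ + 1) → MvPolynomial (Fin 3) ℤ) : Prop :=
  MvPolynomial.aeval ![(ρ : ℂ), X₀, Y₀] (G₁ (Fin.last K₁)) ≠ 0 ∧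
    MvPolynomial.aeval ![(ρ : ℂ), X₀, Y₀] (G₂ (Fin.last K₂)) ≠ 0

/-- **T″ — `IsolatedIntersectionGeneral` (typed, OPEN, ATTACKABLE; the base-point-general functional statement the
paper proof NODE.md §3 establishes: Ax 1971 on a common analytic branch + the log-line enumeration, case 3b being
the one place where `1, ρ, ρ²` free is used).**  For real `ρ` with `1, ρ, ρ²` linearly independent over `ℚ` and a
base point `θ′ = (X₀, Y₀)` off the cut `(-∞, 0]` of the principal logarithm, two coefficient families GENUINE AT θ′
have an ISOLATED intersection of their curves `{Σ G₁ₖ(ρ,X,Y) X^{kρ} = 0}`, `{Σ G₂ₖ(ρ,X,Y) Y^{kρ} = 0}` at θ′. -/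
def IsolatedIntersectionGeneral : Prop :=
  ∀ (ρ : ℝ), LinearIndependent ℚ ![(1 : ℝ), ρ, ρ ^ 2] →
    ∀ (X₀ Y₀ : ℂ), X₀ ∈ Complex.slitPlane → Y₀ ∈ Complex.slitPlane →
      ∀ (K₁ K₂ : ℕ) (G₁ : Fin (K₁ + 1) → MvPolynomial (Fin 3) ℤ) (G₂ : Fin (K₂ + 1) → MvPolynomial (Fin 3) ℤ),
        GenuineAt ρ X₀ Y₀ G₁ G₂ → IsolatedAt' ρ X₀ Y₀ G₁ G₂

/-- The same statement WITHOUT the hypothesis on `ρ` — REFUTED below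
(`isolatedIntersectionGeneral_false_without_rho`): the hypothesis is load-bearing. -/
def IsolatedIntersectionGeneralNoHyp : Prop :=
  ∀ (ρ : ℝ) (X₀ Y₀ : ℂ), X₀ ∈ Complex.slitPlane → Y₀ ∈ Complex.slitPlane →
    ∀ (K₁ K₂ : ℕ) (G₁ : Fin (K₁ + 1) → MvPolynomial (Fin 3) ℤ) (G₂ : Fin (K₂ + 1) → MvPolynomial (Fin 3) ℤ),
      GenuineAt ρ X₀ Y₀ G₁ G₂ → IsolatedAt' ρ X₀ Y₀ G₁ G₂

/-! ### G-2  T″ ⟹ Strong ⟹ T (PROVED) -/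

/-- `e = cexp 1` lies in the slit plane. -/
theorem exp_one_mem_slitPlane : cexp 1 ∈ Complex.slitPlane := by
  have h : cexp 1 = ((Real.exp 1 : ℝ) : ℂ) := by
    rw [Complex.ofReal_exp]; simp
  rw [h]
  exact Complex.ofReal_mem_slitPlane.2 (Real.exp_pos 1)

/-- `e^i` lies off the cut `(-∞, 0]` (`cos 1 > 0`). -/
theorem exp_I_mem_slitPlane : cexp Complex.I ∈ Complex.slitPlane := by
  refine Complex.mem_slitPlane_iff.2 (Or.inl ?_)
  rw [Complex.exp_re, Complex.I_re, Complex.I_im, Real.exp_zero, one_mul]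
  exact Real.cos_pos_of_mem_Ioo ⟨by linarith [Real.pi_gt_three], by linarith [Real.pi_gt_three]⟩

/-- a.i. of `(ρ, e, e^i)` ⟹ `ρ` transcendental. -/
theorem transcendental_of_triple {ρ : ℝ} (h3 : AlgebraicIndependent ℚ (triple ρ)) :
    Transcendental ℚ (ρ : ℂ) := by
  simpa [triple] using h3.transcendental 0

/-- `ρ` transcendental ⟹ `1, ρ, ρ²` are ℚ-linearly independent. -/
theorem linearIndependent_one_rho_sq {ρ : ℝ} (hρ : Transcendental ℚ (ρ : ℂ)) :
    LinearIndependent ℚ ![(1 : ℝ), ρ, ρ ^ 2] := by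
  rw [Fintype.linearIndependent_iff]
  intro g hg
  have hsum : (g 0 : ℝ) + (g 1 : ℝ) * ρ + (g 2 : ℝ) * ρ ^ 2 = 0 := by
    simpa [Fin.sum_univ_three, Rat.smul_def] using hg
  have hsumC : (g 0 : ℂ) + (g 1 : ℂ) * (ρ : ℂ) + (g 2 : ℂ) * (ρ : ℂ) ^ 2 = 0 := by
    have h := congrArg (fun x : ℝ => (x : ℂ)) hsum
    push_cast at h
    simpa using h
  set P : ℚ[X] := Polynomial.C (g 0) + Polynomial.C (g 1) * Polynomial.X + Polynomial.C (g 2) * Polynomial.X ^ 2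
    with hP
  have hPρ : Polynomial.aeval (ρ : ℂ) P = 0 := by
    simp only [hP, map_add, map_mul, map_pow, Polynomial.aeval_C, Polynomial.aeval_X, eq_ratCast]
    exact hsumC
  have hP0 : P = 0 := by
    by_contra hne
    exact hρ ⟨P, hne, hPρ⟩
  have h0 : g 0 = 0 := by simpa [hP] using congrArg (fun Q : ℚ[X] => Q.coeff 0) hP0
  have h1 : g 1 = 0 := by simpa [hP] using congrArg (fun Q : ℚ[X] => Q.coeff 1) hP0
  have h2 : g 2 = 0 := by simpa [hP, Polynomial.coeff_X] using congrArg (fun Q : ℚ[X] => Q.coeff 2) hP0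
  intro i
  fin_cases i
  · exact h0
  · exact h1
  · exact h2

/-- Integer polynomials do not vanish at an algebraically independent point (Step 0 of NODE.md §3). -/
theorem aeval_ne_zero_of_algebraicIndependent {v : Fin 3 → ℂ} (hv : AlgebraicIndependent ℚ v)
    {p : MvPolynomial (Fin 3) ℤ} (hp : p ≠ 0) : MvPolynomial.aeval v p ≠ 0 := by
  intro h
  apply hp
  have h1 : MvPolynomial.aeval v (MvPolynomial.map (algebraMap ℤ ℚ) p) = 0 := by
    rwa [MvPolynomial.aeval_map_algebraMap]
  have h2 : MvPolynomial.map (algebraMap ℤ ℚ) p = 0 :=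
    (algebraicIndependent_iff_injective_aeval.1 hv) (h1.trans (map_zero _).symm)
  exact MvPolynomial.map_injective (algebraMap ℤ ℚ) (algebraMap ℤ ℚ).injective_int (h2.trans (map_zero _).symm)

/-- Genuineness AT `θ = (e, e^i)` follows from the a.i. triple and the non-vanishing of the top coefficients as
POLYNOMIALS (the kernel's `IsRelationPair` / `IsolatedIntersectionStrong` antecedents). -/
theorem genuineAt_theta {ρ : ℝ} (h3 : AlgebraicIndependent ℚ (triple ρ)) {K₁ K₂ : ℕ}
    {G₁ : Fin (K₁ + 1) → MvPolynomial (Fin 3) ℤ} {G₂ : Fin (K₂ + 1) → MvPolynomial (Fin 3) ℤ}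
    (h1 : G₁ (Fin.last K₁) ≠ 0) (h2 : G₂ (Fin.last K₂) ≠ 0) : GenuineAt ρ (cexp 1) (cexp Complex.I) G₁ G₂ :=
  ⟨aeval_ne_zero_of_algebraicIndependent h3 h1, aeval_ne_zero_of_algebraicIndependent h3 h2⟩

/-- **T″ ⟹ Strong (PROVED).** -/
theorem isolatedIntersectionStrong_of_general (hG : IsolatedIntersectionGeneral) (ρ : ℝ) :
    IsolatedIntersectionStrong ρ := fun h3 K₁ K₂ G₁ G₂ h1 h2 =>
  (isolatedAt_iff_isolatedAt' ρ G₁ G₂).2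
    (hG ρ (linearIndependent_one_rho_sq (transcendental_of_triple h3)) (cexp 1) (cexp Complex.I)
      exp_one_mem_slitPlane exp_I_mem_slitPlane K₁ K₂ G₁ G₂ (genuineAt_theta h3 h1 h2))

/-- **T″ ⟹ T (PROVED).** -/
theorem isolatedIntersection_of_general (hG : IsolatedIntersectionGeneral) (ρ : ℝ) : IsolatedIntersection ρ :=
  isolatedIntersection_of_strong (isolatedIntersectionStrong_of_general hG ρ)

/-- **G-5. The cell from T″ and M′** (mod `hLW`, `hX`). -/
theorem four_le_polarDeg_one_of_general (hLW : LWMeasure) (hX : ExplicitRatExpApprox)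
    (hG : IsolatedIntersectionGeneral) {ρ : ℝ} (hρ : LiouvilleOrder 8 ρ) (hM : ApproxOfIsolated ρ) :
    ((2 + 2 : ℕ) : Cardinal) ≤ polarDeg ![(1 : ℝ), ρ] :=
  four_le_polarDeg_one_of_pieces hLW hX hρ (isolatedIntersection_of_general hG ρ) hM

/-! ### G-3  The `ρ`-hypothesis is load-bearing: the critic's witness at `ρ = √2` (PROVED) -/

/-- `𝒞₁ = {X^ρ − Y = 0}`: coefficient family `(−Y, 1)` in `W = X^ρ` (variables `0 ↦ t`, `1 ↦ X`, `2 ↦ Y`). -/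
def Gw₁ : Fin (1 + 1) → MvPolynomial (Fin 3) ℤ := ![-MvPolynomial.X 2, 1]

/-- `𝒞₂ = {Y^ρ − X² = 0}`: coefficient family `(−X², 1)` in `W = Y^ρ`. -/
def Gw₂ : Fin (1 + 1) → MvPolynomial (Fin 3) ℤ := ![-(MvPolynomial.X 1 ^ 2), 1]

/-- The first witness curve evaluates to `W - Y` (i.e. `X^ρ = Y`). -/
theorem relEval_Gw₁ (t X Y W : ℂ) : relEval Gw₁ t X Y W = W - Y := by
  simp [relEval, Gw₁, Fin.sum_univ_succ]
  ring

/-- The second witness curve evaluates to `W - X²` (i.e. `Y^ρ = X²`). -/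
theorem relEval_Gw₂ (t X Y W : ℂ) : relEval Gw₂ t X Y W = W - X ^ 2 := by
  simp [relEval, Gw₂, Fin.sum_univ_succ]
  ring

/-- The witness pair is GENUINE at every base point (top coefficients `1`). -/
theorem genuineAt_witness (ρ : ℝ) (X₀ Y₀ : ℂ) : GenuineAt ρ X₀ Y₀ Gw₁ Gw₂ := by
  have h₁ : Gw₁ (Fin.last 1) = 1 := rfl
  have h₂ : Gw₂ (Fin.last 1) = 1 := rfl
  refine ⟨?_, ?_⟩
  · rw [h₁, map_one]; exact one_ne_zero
  · rw [h₂, map_one]; exact one_ne_zero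

/-- `2` lies off the cut. -/
theorem two_mem_slitPlane : (2 : ℂ) ∈ Complex.slitPlane :=
  Complex.mem_slitPlane_iff.2 (Or.inl (by norm_num))

/-- `2^{√2}` (a positive real) lies off the cut. -/
theorem rpow_sqrt_two_mem_slitPlane : (((2 : ℝ) ^ Real.sqrt 2 : ℝ) : ℂ) ∈ Complex.slitPlane :=
  Complex.ofReal_mem_slitPlane.2 (Real.rpow_pos_of_pos two_pos _)

/-- The principal power of a positive real is the real power. -/
theorem cexp_mul_log_ofReal {y : ℝ} (hy : 0 < y) (s : ℝ) :
    cexp ((s : ℂ) * Complex.log (y : ℂ)) = ((y ^ s : ℝ) : ℂ) := by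
  rw [Complex.ofReal_cpow hy.le, Complex.cpow_def_of_ne_zero (by exact_mod_cast hy.ne'), mul_comm]

/-- **NEGATIVE planted instance (the critic's witness, VERDICT L1819 (δ)(T-i)):** at `ρ = √2`, `θ′ = (2, 2^{√2})`
the genuine pair `Gw₁, Gw₂` is NOT isolated — every real point `(x, x^{√2})`, `x > 0`, lies on BOTH curves, because
`log` of a positive real is real and `(x^{√2})^{√2} = x²`. -/
theorem not_isolatedAt'_sqrt_two :
    ¬ IsolatedAt' (Real.sqrt 2) (2 : ℂ) (((2 : ℝ) ^ Real.sqrt 2 : ℝ) : ℂ) Gw₁ Gw₂ := by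
  rintro ⟨ε, hε, h⟩
  have hc : ContinuousAt (fun x : ℝ => x ^ Real.sqrt 2) 2 :=
    Real.continuousAt_rpow_const 2 (Real.sqrt 2) (Or.inl two_ne_zero)
  obtain ⟨δ, hδ, hδε⟩ := Metric.continuousAt_iff.1 hc ε hε
  obtain ⟨m, hm, hmδ, hmε⟩ : ∃ m : ℝ, 0 < m ∧ m ≤ δ / 2 ∧ m ≤ ε / 2 :=
    ⟨min (δ / 2) (ε / 2), lt_min (by linarith) (by linarith), min_le_left _ _, min_le_right _ _⟩
  have hx : (0 : ℝ) < 2 + m := by linarith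
  have hxδ : dist (2 + m) (2 : ℝ) < δ := by
    rw [Real.dist_eq, add_sub_cancel_left, abs_of_pos hm]; linarith
  have hX : ‖((2 + m : ℝ) : ℂ) - 2‖ < ε := by
    have : ((2 + m : ℝ) : ℂ) - 2 = ((m : ℝ) : ℂ) := by push_cast; ring
    rw [this, Complex.norm_real, Real.norm_eq_abs, abs_of_pos hm]; linarith
  have hY : ‖(((2 + m) ^ Real.sqrt 2 : ℝ) : ℂ) - (((2 : ℝ) ^ Real.sqrt 2 : ℝ) : ℂ)‖ < ε := by
    rw [← Complex.ofReal_sub, Complex.norm_real, Real.norm_eq_abs, ← Real.dist_eq]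
    exact hδε hxδ
  have h1 : relEval Gw₁ (Real.sqrt 2) ((2 + m : ℝ) : ℂ) (((2 + m) ^ Real.sqrt 2 : ℝ) : ℂ)
      (cexp ((Real.sqrt 2 : ℝ) * Complex.log ((2 + m : ℝ) : ℂ))) = 0 := by
    rw [relEval_Gw₁, cexp_mul_log_ofReal hx, sub_self]
  have h2 : relEval Gw₂ (Real.sqrt 2) ((2 + m : ℝ) : ℂ) (((2 + m) ^ Real.sqrt 2 : ℝ) : ℂ)
      (cexp ((Real.sqrt 2 : ℝ) * Complex.log (((2 + m) ^ Real.sqrt 2 : ℝ) : ℂ))) = 0 := by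
    rw [relEval_Gw₂, cexp_mul_log_ofReal (Real.rpow_pos_of_pos hx _), ← Real.rpow_mul hx.le,
      Real.mul_self_sqrt zero_le_two, Real.rpow_two]
    push_cast; ring
  have hfix := (h _ _ hX hY h1 h2).1
  have : (2 + m : ℝ) = 2 := by exact_mod_cast hfix
  linarith

/-- **`_false_without_` control (PROVED):** T″ WITHOUT its hypothesis on `ρ` is FALSE. -/
theorem isolatedIntersectionGeneral_false_without_rho : ¬ IsolatedIntersectionGeneralNoHyp := fun h =>
  not_isolatedAt'_sqrt_two
    (h (Real.sqrt 2) 2 _ two_mem_slitPlane rpow_sqrt_two_mem_slitPlane 1 1 Gw₁ Gw₂ (genuineAt_witness _ _ _))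

/-- … and the witness `ρ = √2` violates exactly T″'s hypothesis: `2·1 + 0·√2 − 1·√2² = 0`. -/
theorem not_linearIndependent_sqrt_two :
    ¬ LinearIndependent ℚ ![(1 : ℝ), Real.sqrt 2, Real.sqrt 2 ^ 2] := by
  rw [Fintype.not_linearIndependent_iff]
  refine ⟨![2, 0, -1], ?_, ⟨0, by simp⟩⟩
  simp [Fin.sum_univ_three, Rat.smul_def, Real.sq_sqrt (zero_le_two : (0 : ℝ) ≤ 2)]

/-! ### G-4  A POSITIVE non-trivial instance: principal-branch locality (PROVED) -/

/-- `𝒞 = {W − 1 = 0}`: coefficient family `(−1, 1)`. -/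
def Gp : Fin (1 + 1) → MvPolynomial (Fin 3) ℤ := ![-1, 1]

/-- The positive-instance curve evaluates to `W - 1` (i.e. `X^ρ = 1`, resp. `Y^ρ = 1`). -/
theorem relEval_Gp (t X Y W : ℂ) : relEval Gp t X Y W = W - 1 := by
  simp [relEval, Gp, Fin.sum_univ_succ]
  ring

/-- The positive-instance pair is genuine at `(1, 1)` (top coefficients are the constant `1`). -/
theorem genuineAt_one_one (ρ : ℝ) : GenuineAt ρ 1 1 Gp Gp := by
  have h : Gp (Fin.last 1) = 1 := rfl
  refine ⟨?_, ?_⟩ <;> (rw [h, map_one]; exact one_ne_zero)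

/-- Principal-branch locality: near `X = 1`, `exp(ρ log X) = 1` forces `X = 1` (`ρ ≠ 0` real), because
`|ρ · log X| < 2π` leaves only the period `0`. -/
theorem eq_one_of_cexp_mul_log_eq_one {ρ : ℝ} (hρ : ρ ≠ 0) :
    ∃ ε : ℝ, 0 < ε ∧ ∀ X : ℂ, ‖X - 1‖ < ε → cexp (ρ * Complex.log X) = 1 → X = 1 := by
  have hρpos : 0 < |ρ| := abs_pos.2 hρ
  have hc : ContinuousAt Complex.log 1 := continuousAt_clog (by simp)
  obtain ⟨δ, hδ, hδ'⟩ := Metric.continuousAt_iff.1 hc (2 * Real.pi / |ρ|) (by positivity)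
  refine ⟨min δ 1, lt_min hδ one_pos, fun X hX hexp => ?_⟩
  have hXδ : dist X 1 < δ := by
    rw [dist_eq_norm]; exact lt_of_lt_of_le hX (min_le_left _ _)
  have hX0 : X ≠ 0 := by
    intro h0
    rw [h0, zero_sub, norm_neg, norm_one] at hX
    linarith [min_le_right δ 1]
  have hlog : ‖Complex.log X‖ < 2 * Real.pi / |ρ| := by
    have := hδ' hXδ
    rwa [dist_eq_norm, Complex.log_one, sub_zero] at this
  obtain ⟨n, hn⟩ := Complex.exp_eq_one_iff.1 hexp
  have hnorm : ‖(ρ : ℂ) * Complex.log X‖ < 2 * Real.pi := by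
    rw [norm_mul, Complex.norm_real, Real.norm_eq_abs]
    calc |ρ| * ‖Complex.log X‖ < |ρ| * (2 * Real.pi / |ρ|) := mul_lt_mul_of_pos_left hlog hρpos
      _ = 2 * Real.pi := by field_simp
  have hn0 : n = 0 := by
    rw [hn] at hnorm
    have h2 : ‖(n : ℂ) * (2 * Real.pi * Complex.I)‖ = |(n : ℝ)| * (2 * Real.pi) := by
      rw [norm_mul, norm_mul, norm_mul, Complex.norm_intCast, Complex.norm_I, mul_one, Complex.norm_real,
        Real.norm_of_nonneg Real.pi_pos.le, Complex.norm_two]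
    rw [h2] at hnorm
    have h3 : |(n : ℝ)| < 1 := by
      by_contra hge
      rw [not_lt] at hge
      have : 1 * (2 * Real.pi) ≤ |(n : ℝ)| * (2 * Real.pi) :=
        mul_le_mul_of_nonneg_right hge (by positivity)
      linarith
    have h4 : |n| < 1 := by exact_mod_cast h3
    exact Int.abs_lt_one_iff.1 h4
  rw [hn0, Int.cast_zero, zero_mul] at hn
  have hlog0 : Complex.log X = 0 := by
    rcases mul_eq_zero.1 hn with h | h
    · exact absurd (by exact_mod_cast h : ρ = 0) hρ
    · exact h
  rw [← Complex.exp_log hX0, hlog0, Complex.exp_zero]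

/-- **POSITIVE non-trivial planted instance of `IsolatedAt'` (PROVED):** at `θ′ = (1, 1)`, for ANY real `ρ ≠ 0`,
the curves `{X^ρ = 1}`, `{Y^ρ = 1}` (principal branches) meet in the ISOLATED point `(1, 1)` — although for
irrational `ρ` the full multivalued curves `{exp(ρ(log X + 2πik)) = 1}` accumulate at every circle point: the
LOCALITY of the principal branch is what the predicate sees.  With `genuineAt_one_one` this is a non-vacuous
instance of T″'s conclusion. -/
theorem isolatedAt'_one_one {ρ : ℝ} (hρ : ρ ≠ 0) : IsolatedAt' ρ 1 1 Gp Gp := by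
  obtain ⟨ε, hε, h⟩ := eq_one_of_cexp_mul_log_eq_one hρ
  refine ⟨ε, hε, fun X Y hX hY h1 h2 => ⟨h X hX ?_, h Y hY ?_⟩⟩
  · rwa [relEval_Gp, sub_eq_zero] at h1
  · rwa [relEval_Gp, sub_eq_zero] at h2

/-- Readback: T″ verbatim. -/
theorem isolatedIntersectionGeneral_iff : IsolatedIntersectionGeneral ↔
    (∀ (ρ : ℝ), LinearIndependent ℚ ![(1 : ℝ), ρ, ρ ^ 2] →
      ∀ (X₀ Y₀ : ℂ), X₀ ∈ Complex.slitPlane → Y₀ ∈ Complex.slitPlane →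
        ∀ (K₁ K₂ : ℕ) (G₁ : Fin (K₁ + 1) → MvPolynomial (Fin 3) ℤ) (G₂ : Fin (K₂ + 1) → MvPolynomial (Fin 3) ℤ),
          GenuineAt ρ X₀ Y₀ G₁ G₂ → IsolatedAt' ρ X₀ Y₀ G₁ G₂) := Iff.rfl

end General

end G03part

end Summit.Schanuel.Schanuel.Theorems.RootDecomp1BMovingZero

end
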